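import Summits.HubbardSuperconductivity.HubbardSuperconductivity.Theorems.KLProgrammeKLRegimeScaleZeroCovarianceOffSiteSpatialEnvelope
import Summits.HubbardSuperconductivity.HubbardSuperconductivity.Theorems.KLProgrammeKLRegimeEngineScaleZeroE4Geometry
import Summits.HubbardSuperconductivity.HubbardSuperconductivity.Theorems.KLProgrammeKLRegimeEnginePlaneWavePhases
import Literature.MathematicalPhysics.QuantumLattice.HubbardFreePropagatorTorusDecay

/-!
# Route `KLProgramme`, crux K3 — engine-flow child (stmt-HubbardSuperconductivity-20437), stub (C) at `n = 0`, located brick «A-SIZES-WEIGHTED» (pen (R181)),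
# brick 4d: THE WEIGHTED GRID SUMS — time sums over the cyclic distance (Gibbs/harmonic and decay/telescoping), the centred spatial representative,
# and the CORE LEMMA turning a pointwise decay shape into the weighted size `a·N/β`

Cell gate-hubbard-kl, seat p1 g21.  Model-free bookkeeping for the weighted row/column sizes of the scale-`0` grid covariance (brick 4e):
* §1 `sum_range_inv_one_add_mul_pow_le` (`Σ_{i≤K} (1+εi)^{−r} ≤ 1 + 1/ε`, `r ≥ 2`, telescoping), `sum_range_ite_pow_div_le`
  (`Σ_{1≤i≤K} (1+εi)^k/i ≤ (1+εK)^k(1+log K)`, harmonic), **`sum_fin_cyclicDist_le`** (`Σ_{j₁∈ℤ/N} g(cyclicDist(j₀,j₁)) ≤ 2Σ_{i≤N} g(i)` for `g ≥ 0`);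
* §2 the centred representative `z_c(u) = (valMinAbs u_j)_j ∈ ℤ²`: `torusSiteDist_le_norm_centredRep`, `norm_centredRep_neg`, `centredRep_injective`,
  **`sum_torusSite_inv_pow_centredRep_le_tsum`** (`Σ_{x₁} (1+‖z_c(x₁−x₀)‖)^{−4} ≤ S₄ = Σ'_{z∈ℤ²}(1+‖z‖)^{−4}`);
* §3 **`weightedGridSum_le_of_decayShape`** — if `F(p₁) ≤ [v ≥ 1]·ED(x₁)/v + G(x₁)·(1 + εv/ℓ)^{−(k+2)}` (`v = cyclicDist_N(j₀,j₁)`, `ε = β/N`, on-site constants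
  `EDon, Gon`, off-site `EDoff·(1+‖z_c‖)^{−(k+4)}`, `Goff·(1+‖z_c‖)^{−(k+4)}`), then for `0 ≤ λ ≤ 1`, `λℓ ≤ 1`:
  `Σ_{p₁} F(p₁)·(1+λ·d(p₀,p₁))^k ≤ 2(1+β)^k(1+log N)·(EDon + EDoff·S₄) + 2(1+ℓN/β)·(Gon + Goff·S₄)` (`d` = `gridLabelDist`'s pair value).

Proofs only; no definitions; nothing here asserts (C), any stub of 20437, K3 or superconductivity.  References: BGM 2006 §2.2 (2.36aa), §2.4 (2.80)
[cite: BenfattoGiulianiMastropietro2006]; de Siqueira Pedra–Salmhofer 2008 §4 Cor. 4.4 (`α_C`) [cite: PedraSalmhofer2008].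
-/

noncomputable section

namespace Summit.HubbardSuperconductivity.HubbardSuperconductivity.Theorems.KLRegimeSplit

set_option linter.dupNamespace false -- summit = problem name (single-conjunct summit), D-0017

open Literature.MathematicalPhysics.QuantumLattice Literature.Probability.LatticeModels
open Finset Real

variable {L : ℕ} [NeZero L]

/-! ## §1 Time sums over the cyclic distance -/

/-- **Telescoping decay sum**: `Σ_{i ≤ K} (1+εi)^{−r} ≤ 1 + 1/ε` (`0 < ε`, `r ≥ 2`). -/
theorem sum_range_inv_one_add_mul_pow_le {ε : ℝ} (hε : 0 < ε) {r : ℕ} (hr : 2 ≤ r) (K : ℕ) :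
    ∑ i ∈ Finset.range (K + 1), ((1 + ε * i) ^ r)⁻¹ ≤ 1 + 1 / ε := by
  rw [Finset.sum_range_succ']
  simp only [Nat.cast_zero, mul_zero, add_zero, one_pow, inv_one, Nat.cast_succ]
  suffices h : ∑ i ∈ Finset.range K, ((1 + ε * ((i : ℝ) + 1)) ^ r)⁻¹ ≤ 1 / ε by linarith
  have hstep : ∀ i : ℕ, ((1 + ε * ((i : ℝ) + 1)) ^ r)⁻¹ ≤ (1 / ε) * ((1 + ε * i)⁻¹ - (1 + ε * ((i : ℝ) + 1))⁻¹) := by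
    intro i
    have ha : 0 < 1 + ε * (i : ℝ) := by positivity
    have hb : 0 < 1 + ε * ((i : ℝ) + 1) := by positivity
    have hab : 1 + ε * (i : ℝ) ≤ 1 + ε * ((i : ℝ) + 1) := by nlinarith
    have hb1 : 1 ≤ 1 + ε * ((i : ℝ) + 1) := by nlinarith
    calc ((1 + ε * ((i : ℝ) + 1)) ^ r)⁻¹ ≤ ((1 + ε * ((i : ℝ) + 1)) ^ 2)⁻¹ := by
          rw [inv_le_inv₀ (by positivity) (by positivity)]
          exact pow_le_pow_right₀ hb1 hr
      _ ≤ ((1 + ε * (i : ℝ)) * (1 + ε * ((i : ℝ) + 1)))⁻¹ := by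
          rw [inv_le_inv₀ (by positivity) (by positivity), sq]
          exact mul_le_mul_of_nonneg_right hab hb.le
      _ = (1 / ε) * ((1 + ε * i)⁻¹ - (1 + ε * ((i : ℝ) + 1))⁻¹) := by
          field_simp
          ring
  calc ∑ i ∈ Finset.range K, ((1 + ε * ((i : ℝ) + 1)) ^ r)⁻¹
      ≤ ∑ i ∈ Finset.range K, (1 / ε) * ((1 + ε * i)⁻¹ - (1 + ε * ((i : ℝ) + 1))⁻¹) := Finset.sum_le_sum fun i _ => hstep i
    _ = (1 / ε) * ((1 + ε * ((0 : ℕ) : ℝ))⁻¹ - (1 + ε * ((K : ℕ) : ℝ))⁻¹) := by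
        have htel := Finset.sum_range_sub' (fun i : ℕ => (1 + ε * (i : ℝ))⁻¹) K
        simp only [Nat.cast_succ] at htel
        rw [← Finset.mul_sum, htel]
    _ ≤ 1 / ε := by
        rw [Nat.cast_zero, mul_zero, add_zero, inv_one]
        have : 0 ≤ (1 + ε * ((K : ℕ) : ℝ))⁻¹ := by positivity
        have hε' : 0 ≤ 1 / ε := by positivity
        nlinarith

/-- **Harmonic edge sum**: `Σ_{1 ≤ i ≤ K} (1+εi)^k/i ≤ (1+εK)^k·(1 + log K)` (`0 ≤ ε`; the `i = 0` term is absent). -/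
theorem sum_range_ite_pow_div_le {ε : ℝ} (hε : 0 ≤ ε) (k K : ℕ) :
    ∑ i ∈ Finset.range (K + 1), (if i = 0 then (0 : ℝ) else (1 + ε * i) ^ k / i) ≤ (1 + ε * K) ^ k * (1 + Real.log K) := by
  rw [Finset.sum_range_succ']
  simp only [if_true, add_zero, Nat.succ_ne_zero, if_false, Nat.cast_succ]
  have hharm := harmonic_le_one_add_log K
  have hcast : ((harmonic K : ℚ) : ℝ) = ∑ i ∈ Finset.range K, (((i : ℝ) + 1))⁻¹ := by
    simp only [harmonic]; push_cast; rfl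
  rw [hcast] at hharm
  calc ∑ i ∈ Finset.range K, (1 + ε * ((i : ℝ) + 1)) ^ k / ((i : ℝ) + 1)
      ≤ ∑ i ∈ Finset.range K, (1 + ε * K) ^ k * (((i : ℝ) + 1))⁻¹ := by
        refine Finset.sum_le_sum fun i hi => ?_
        rw [Finset.mem_range] at hi
        rw [div_eq_mul_inv]
        refine mul_le_mul_of_nonneg_right (pow_le_pow_left₀ (by positivity) ?_ k) (by positivity)
        have : (i : ℝ) + 1 ≤ K := by exact_mod_cast hi
        nlinarith
    _ = (1 + ε * K) ^ k * ∑ i ∈ Finset.range K, (((i : ℝ) + 1))⁻¹ := by rw [Finset.mul_sum]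
    _ ≤ (1 + ε * K) ^ k * (1 + Real.log K) := mul_le_mul_of_nonneg_left hharm (by positivity)

/-- **Sums over the cyclic distance**: for `g ≥ 0` and a fixed grid time `j₀ ∈ ℤ/N`,
`Σ_{j₁ : Fin N} g(min(v, N − v)) ≤ 2·Σ_{i ≤ N} g(i)`, `v = val(j₀ − j₁)` (every cyclic distance is attained at most twice). -/
theorem sum_fin_cyclicDist_le {N : ℕ} [NeZero N] (g : ℕ → ℝ) (hg : ∀ i, 0 ≤ g i) (j₀ : Fin N) :
    ∑ j₁ : Fin N, g (min (((j₀ : ℕ) : ZMod N) - ((j₁ : ℕ) : ZMod N)).val (N - (((j₀ : ℕ) : ZMod N) - ((j₁ : ℕ) : ZMod N)).val)) ≤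
      2 * ∑ i ∈ Finset.range (N + 1), g i := by
  have hNpos : 0 < N := Nat.pos_of_ne_zero (NeZero.ne N)
  set T : ZMod N → ℝ := fun a => g (min a.val (N - a.val)) with hT
  -- `j ↦ (j : ZMod N)` is a bijection `Fin N → ZMod N`
  set f : Fin N → ZMod N := fun j => ((j : ℕ) : ZMod N) with hf
  have hfinj : Function.Injective f := by
    intro a b hab
    have h := congrArg ZMod.val hab
    simp only [hf, ZMod.val_natCast, Nat.mod_eq_of_lt a.isLt, Nat.mod_eq_of_lt b.isLt] at h
    exact Fin.ext h
  have hfbij : Function.Bijective f := by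
    rw [Fintype.bijective_iff_injective_and_card]
    exact ⟨hfinj, by simp⟩
  -- translate by `j₀` and sum over `ℤ/N`
  have h1 : ∑ j₁ : Fin N, g (min (((j₀ : ℕ) : ZMod N) - ((j₁ : ℕ) : ZMod N)).val (N - (((j₀ : ℕ) : ZMod N) - ((j₁ : ℕ) : ZMod N)).val)) =
      ∑ a : ZMod N, T (((j₀ : ℕ) : ZMod N) - a) :=
    Function.Bijective.sum_comp hfbij (fun a => T (((j₀ : ℕ) : ZMod N) - a))
  have h2 : ∑ a : ZMod N, T (((j₀ : ℕ) : ZMod N) - a) = ∑ a : ZMod N, T a :=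
    Fintype.sum_equiv (Equiv.subLeft (((j₀ : ℕ) : ZMod N))) _ _ fun a => rfl
  have h3 : ∑ a : ZMod N, T a = ∑ i ∈ Finset.range N, g (min i (N - i)) := by
    rw [← Function.Bijective.sum_comp hfbij T]
    simp only [hT, hf, ZMod.val_natCast]
    rw [Fin.sum_univ_eq_sum_range (fun i : ℕ => g (min (i % N) (N - i % N))) N]
    exact Finset.sum_congr rfl fun i hi => by rw [Finset.mem_range] at hi; rw [Nat.mod_eq_of_lt hi]
  rw [h1, h2, h3]
  -- `g(min(i, N−i)) ≤ g(i) + g(N−i)` and reflect the second sum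
  have h4 : ∀ i ∈ Finset.range N, g (min i (N - i)) ≤ g i + g (N - i) := by
    intro i _
    rcases min_choice i (N - i) with h | h <;> rw [h] <;> linarith [hg i, hg (N - i)]
  refine (Finset.sum_le_sum h4).trans ?_
  rw [Finset.sum_add_distrib, two_mul]
  refine add_le_add ?_ ?_
  · rw [Finset.sum_range_succ]; linarith [hg N]
  · have hrefl := Finset.sum_range_reflect (fun j => g (j + 1)) N
    have heq : ∑ i ∈ Finset.range N, g (N - i) = ∑ j ∈ Finset.range N, g (j + 1) := by
      rw [← hrefl]
      exact Finset.sum_congr rfl fun i hi => by rw [Finset.mem_range] at hi; congr 1; omega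
    rw [heq, Finset.sum_range_succ']
    linarith [hg 0]

/-! ## §2 The centred representative of a torus difference -/

/-- The torus `ℓ^∞` distance is at most the sup norm of the centred representative: `torusSiteDist x₀ x₁ ≤ ‖(valMinAbs (x₁ − x₀)_j)_j‖`. -/
theorem torusSiteDist_le_norm_centredRep (x₀ x₁ : TorusSite 2 L) :
    torusSiteDist x₀ x₁ ≤ ‖(fun j => ((x₁ - x₀) j).valMinAbs : Site 2)‖ := by
  rw [EngineV8.torusSiteDist_eq_max_circDist L x₀ x₁]
  have hj : ∀ j : Fin 2, (circDist L (x₀ j).val (x₁ j).val : ℝ) ≤ ‖(fun j => ((x₁ - x₀) j).valMinAbs : Site 2)‖ := by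
    intro j
    rw [EngineV8.circDist_val_cast_eq_abs_valMinAbs]
    have h1 : |(((x₀ j - x₁ j).valMinAbs : ℤ) : ℝ)| = |((((x₁ - x₀) j).valMinAbs : ℤ) : ℝ)| := by
      rw [← Int.cast_abs, ← Int.cast_abs, Int.abs_eq_natAbs, Int.abs_eq_natAbs, Pi.sub_apply,
        show x₀ j - x₁ j = -(x₁ j - x₀ j) by ring, ZMod.natAbs_valMinAbs_neg]
    rw [h1, ← Int.norm_eq_abs]
    exact norm_le_pi_norm (fun j => ((x₁ - x₀) j).valMinAbs : Site 2) j
  exact max_le (hj 0) (hj 1)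

omit [NeZero L] in
/-- `‖z_c(−u)‖ = ‖z_c(u)‖`. -/
theorem norm_centredRep_neg (u : TorusSite 2 L) :
    ‖(fun j => ((-u) j).valMinAbs : Site 2)‖ = ‖(fun j => (u j).valMinAbs : Site 2)‖ := by
  simp only [Pi.norm_def]
  congr 1
  refine Finset.sup_congr rfl fun j _ => ?_
  rw [← NNReal.natCast_natAbs, ← NNReal.natCast_natAbs, Pi.neg_apply, ZMod.natAbs_valMinAbs_neg]

omit [NeZero L] in
/-- The centred representative is injective. -/
theorem centredRep_injective : Function.Injective (fun u : TorusSite 2 L => (fun j => (u j).valMinAbs : Site 2)) := by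
  intro u u' h
  funext j
  have hj := congrFun h j
  simp only at hj
  rw [← ZMod.coe_valMinAbs (u j), ← ZMod.coe_valMinAbs (u' j), hj]

/-- **The spatial decay sum against the lattice constant**: `Σ_{x₁} (1+‖z_c(x₁ − x₀)‖)^{−4} ≤ S₄ = Σ'_{z∈ℤ²} (1+‖z‖)^{−4}`. -/
theorem sum_torusSite_inv_pow_centredRep_le_tsum (x₀ : TorusSite 2 L) :
    ∑ x₁ : TorusSite 2 L, ((1 + ‖(fun j => ((x₁ - x₀) j).valMinAbs : Site 2)‖) ^ 4)⁻¹ ≤ ∑' z : Site 2, ((1 + ‖z‖) ^ 4)⁻¹ := by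
  have hS := summable_inv_one_add_norm_pow (d := 2) (K := 4) (by norm_num)
  have h1 : ∑ x₁ : TorusSite 2 L, ((1 + ‖(fun j => ((x₁ - x₀) j).valMinAbs : Site 2)‖) ^ 4)⁻¹ =
      ∑ u : TorusSite 2 L, ((1 + ‖(fun j => (u j).valMinAbs : Site 2)‖) ^ 4)⁻¹ :=
    Fintype.sum_equiv (Equiv.subRight x₀) _ _ fun x₁ => rfl
  rw [h1, ← Finset.sum_image (f := fun z : Site 2 => ((1 + ‖z‖) ^ 4)⁻¹) fun u _ u' _ h => centredRep_injective h]
  exact hS.sum_le_tsum _ fun z _ => by positivity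

/-! ## §3 The core lemma: a pointwise decay shape gives the weighted size -/

/-- Splitting the pair weight: `(1 + λ(a + b))^k ≤ (1 + a')^k·(1 + b')^k` when `λa ≤ a'`, `λb ≤ b'` (`a, b, a', b' ≥ 0`). -/
theorem one_add_mul_add_pow_le {lam a b a' b' : ℝ} (ha : 0 ≤ a') (hb : 0 ≤ b') (haa : lam * a ≤ a') (hbb : lam * b ≤ b') (k : ℕ)
    (h0 : 0 ≤ 1 + lam * (a + b)) : (1 + lam * (a + b)) ^ k ≤ (1 + a') ^ k * (1 + b') ^ k := by
  rw [← mul_pow]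
  refine pow_le_pow_left₀ h0 ?_ k
  nlinarith [mul_nonneg ha hb]

/-- **THE CORE LEMMA.**  On the `N`-point grid (`0 < β`, `ε = β/N`), fix `p₀ = (j₀, x₀)`, `k`, `ℓ > 0`, `0 ≤ λ ≤ 1` with `λℓ ≤ 1`, nonnegative constants
`EDon, EDoff, Gon, Goff`, and suppose the POINTWISE DECAY SHAPE
`F(p₁) ≤ [v ≠ 0]·ED(x₁)/v + G(x₁)·(1 + εv/ℓ)^{−(k+2)}`, `v = cyclicDist_N(j₀, j₁)`, `ED(x₁) = EDon` (`x₁ = x₀`) / `EDoff·(1+‖z_c(x₁−x₀)‖)^{−(k+4)}` (else), same for `G`.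
Then `Σ_{p₁} F(p₁)·(1 + λ(εv + torusSiteDist x₀ x₁))^k ≤ 2(1+β)^k(1+log N)·(EDon + EDoff·S₄) + 2(1 + ℓN/β)·(Gon + Goff·S₄)`. -/
theorem weightedGridSum_le_of_decayShape {N : ℕ} [NeZero N] {β : ℝ} (hβ : 0 < β) {ℓ : ℝ} (hℓ : 0 < ℓ) {lam : ℝ}
    (hlam0 : 0 ≤ lam) (hlam1 : lam ≤ 1) (hlamℓ : lam * ℓ ≤ 1) (k : ℕ) (p₀ : GridPoint L N) {EDon EDoff Gon Goff : ℝ} (hEDon : 0 ≤ EDon)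
    (hEDoff : 0 ≤ EDoff) (hGon : 0 ≤ Gon) (hGoff : 0 ≤ Goff) (F : GridPoint L N → ℝ)
    (hF : ∀ p₁ : GridPoint L N, F p₁ ≤
      (if cyclicDist N ((p₀.1 : ℕ) : ZMod N) ((p₁.1 : ℕ) : ZMod N) = 0 then 0 else
        (if p₁.2 = p₀.2 then EDon else EDoff * ((1 + ‖(fun j => ((p₁.2 - p₀.2) j).valMinAbs : Site 2)‖) ^ (k + 4))⁻¹) /
          cyclicDist N ((p₀.1 : ℕ) : ZMod N) ((p₁.1 : ℕ) : ZMod N)) +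
      (if p₁.2 = p₀.2 then Gon else Goff * ((1 + ‖(fun j => ((p₁.2 - p₀.2) j).valMinAbs : Site 2)‖) ^ (k + 4))⁻¹) *
        ((1 + β / N * cyclicDist N ((p₀.1 : ℕ) : ZMod N) ((p₁.1 : ℕ) : ZMod N) / ℓ) ^ (k + 2))⁻¹) :
    ∑ p₁ : GridPoint L N, F p₁ * (1 + lam * (β / N * cyclicDist N ((p₀.1 : ℕ) : ZMod N) ((p₁.1 : ℕ) : ZMod N) + torusSiteDist p₀.2 p₁.2)) ^ k ≤
      2 * (1 + β) ^ k * (1 + Real.log N) * (EDon + EDoff * ∑' z : Site 2, ((1 + ‖z‖) ^ 4)⁻¹) +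
        2 * (1 + ℓ * N / β) * (Gon + Goff * ∑' z : Site 2, ((1 + ‖z‖) ^ 4)⁻¹) := by
  have hN : (0 : ℝ) < N := by exact_mod_cast Nat.pos_of_ne_zero (NeZero.ne N)
  set ε : ℝ := β / N with hε
  have hε0 : 0 < ε := by positivity
  set S : ℝ := ∑' z : Site 2, ((1 + ‖z‖) ^ 4)⁻¹ with hSdef
  have hS0 : 0 ≤ S := tsum_nonneg fun _ => by positivity
  -- abbreviations
  set cd : GridPoint L N → ℝ := fun p₁ => cyclicDist N ((p₀.1 : ℕ) : ZMod N) ((p₁.1 : ℕ) : ZMod N) with hcd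
  set zc : TorusSite 2 L → Site 2 := fun x₁ => fun j => ((x₁ - p₀.2) j).valMinAbs with hzc
  set ED : TorusSite 2 L → ℝ := fun x₁ => if x₁ = p₀.2 then EDon else EDoff * ((1 + ‖zc x₁‖) ^ (k + 4))⁻¹ with hED
  set G : TorusSite 2 L → ℝ := fun x₁ => if x₁ = p₀.2 then Gon else Goff * ((1 + ‖zc x₁‖) ^ (k + 4))⁻¹ with hG
  have hcd0 : ∀ p₁, 0 ≤ cd p₁ := fun p₁ => (isLabelDist_cyclicDist N).nonneg _ _
  have hED0 : ∀ x₁, 0 ≤ ED x₁ := fun x₁ => by simp only [hED]; split_ifs <;> positivity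
  have hG0 : ∀ x₁, 0 ≤ G x₁ := fun x₁ => by simp only [hG]; split_ifs <;> positivity
  have hdx : ∀ x₁, torusSiteDist p₀.2 x₁ ≤ ‖zc x₁‖ := fun x₁ => torusSiteDist_le_norm_centredRep p₀.2 x₁
  have hdx0 : ∀ x₁, 0 ≤ torusSiteDist p₀.2 x₁ := fun x₁ => isLabelDist_torusSiteDist.nonneg _ _
  -- (1) pointwise: `F·W ≤ (1+‖z_c‖)^k·(ED·[v≠0](1+εv)^k/v + G·(1+εv/ℓ)^{-2})`
  have hpt : ∀ p₁ : GridPoint L N, F p₁ * (1 + lam * (ε * cd p₁ + torusSiteDist p₀.2 p₁.2)) ^ k ≤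
      (1 + ‖zc p₁.2‖) ^ k * (ED p₁.2 * (if cd p₁ = 0 then 0 else (1 + ε * cd p₁) ^ k / cd p₁) +
        G p₁.2 * ((1 + ε / ℓ * cd p₁) ^ 2)⁻¹) := by
    intro p₁
    have hW0 : 0 ≤ 1 + lam * (ε * cd p₁ + torusSiteDist p₀.2 p₁.2) := by
      have := hcd0 p₁; have := hdx0 p₁.2; positivity
    have hdxl : lam * torusSiteDist p₀.2 p₁.2 ≤ ‖zc p₁.2‖ := (mul_le_of_le_one_left (hdx0 _) hlam1).trans (hdx _)
    have hW1 : (1 + lam * (ε * cd p₁ + torusSiteDist p₀.2 p₁.2)) ^ k ≤ (1 + ε * cd p₁) ^ k * (1 + ‖zc p₁.2‖) ^ k :=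
      one_add_mul_add_pow_le (by have := hcd0 p₁; positivity) (norm_nonneg _)
        (mul_le_of_le_one_left (by have := hcd0 p₁; positivity) hlam1) hdxl k hW0
    have hW2 : (1 + lam * (ε * cd p₁ + torusSiteDist p₀.2 p₁.2)) ^ k ≤ (1 + ε / ℓ * cd p₁) ^ k * (1 + ‖zc p₁.2‖) ^ k := by
      refine one_add_mul_add_pow_le (by have := hcd0 p₁; positivity) (norm_nonneg _) ?_ hdxl k hW0
      have h1 : lam ≤ 1 / ℓ := by rw [le_div_iff₀ hℓ]; exact hlamℓ
      have := hcd0 p₁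
      calc lam * (ε * cd p₁) ≤ (1 / ℓ) * (ε * cd p₁) := mul_le_mul_of_nonneg_right h1 (by positivity)
        _ = ε / ℓ * cd p₁ := by ring
    -- split `F ≤ EDterm + Gterm` and multiply each by the matching weight bound
    have hEDterm0 : 0 ≤ (if cd p₁ = 0 then 0 else ED p₁.2 / cd p₁) := by
      split_ifs; exacts [le_rfl, div_nonneg (hED0 _) (hcd0 _)]
    have hGterm0 : 0 ≤ G p₁.2 * ((1 + ε * cd p₁ / ℓ) ^ (k + 2))⁻¹ := by
      have := hcd0 p₁; have := hG0 p₁.2; positivity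
    have hFle : F p₁ ≤ (if cd p₁ = 0 then 0 else ED p₁.2 / cd p₁) + G p₁.2 * ((1 + ε * cd p₁ / ℓ) ^ (k + 2))⁻¹ := hF p₁
    have hk0 : (1 + ε / ℓ * cd p₁) ^ k ≠ 0 := by have := hcd0 p₁; positivity
    have hcdk : ∀ c : ℝ, (if cd p₁ = 0 then 0 else c / cd p₁) * ((1 + ε * cd p₁) ^ k * (1 + ‖zc p₁.2‖) ^ k) =
        (1 + ‖zc p₁.2‖) ^ k * (c * (if cd p₁ = 0 then 0 else (1 + ε * cd p₁) ^ k / cd p₁)) := fun c => by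
      split_ifs <;> ring
    have hGk : G p₁.2 * ((1 + ε * cd p₁ / ℓ) ^ (k + 2))⁻¹ * ((1 + ε / ℓ * cd p₁) ^ k * (1 + ‖zc p₁.2‖) ^ k) =
        (1 + ‖zc p₁.2‖) ^ k * (G p₁.2 * ((1 + ε / ℓ * cd p₁) ^ 2)⁻¹) := by
      rw [show 1 + ε * cd p₁ / ℓ = 1 + ε / ℓ * cd p₁ by ring, pow_add, mul_inv]
      have h1 : ((1 + ε / ℓ * cd p₁) ^ k)⁻¹ * (1 + ε / ℓ * cd p₁) ^ k = 1 := inv_mul_cancel₀ hk0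
      linear_combination (G p₁.2 * ((1 + ε / ℓ * cd p₁) ^ 2)⁻¹ * (1 + ‖zc p₁.2‖) ^ k) * h1
    calc F p₁ * (1 + lam * (ε * cd p₁ + torusSiteDist p₀.2 p₁.2)) ^ k
        ≤ ((if cd p₁ = 0 then 0 else ED p₁.2 / cd p₁) + G p₁.2 * ((1 + ε * cd p₁ / ℓ) ^ (k + 2))⁻¹) *
            (1 + lam * (ε * cd p₁ + torusSiteDist p₀.2 p₁.2)) ^ k := mul_le_mul_of_nonneg_right hFle (pow_nonneg hW0 _)
      _ = (if cd p₁ = 0 then 0 else ED p₁.2 / cd p₁) * (1 + lam * (ε * cd p₁ + torusSiteDist p₀.2 p₁.2)) ^ k +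
            G p₁.2 * ((1 + ε * cd p₁ / ℓ) ^ (k + 2))⁻¹ * (1 + lam * (ε * cd p₁ + torusSiteDist p₀.2 p₁.2)) ^ k := by ring
      _ ≤ (if cd p₁ = 0 then 0 else ED p₁.2 / cd p₁) * ((1 + ε * cd p₁) ^ k * (1 + ‖zc p₁.2‖) ^ k) +
            G p₁.2 * ((1 + ε * cd p₁ / ℓ) ^ (k + 2))⁻¹ * ((1 + ε / ℓ * cd p₁) ^ k * (1 + ‖zc p₁.2‖) ^ k) :=
          add_le_add (mul_le_mul_of_nonneg_left hW1 hEDterm0) (mul_le_mul_of_nonneg_left hW2 hGterm0)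
      _ = (1 + ‖zc p₁.2‖) ^ k * (ED p₁.2 * (if cd p₁ = 0 then 0 else (1 + ε * cd p₁) ^ k / cd p₁) +
            G p₁.2 * ((1 + ε / ℓ * cd p₁) ^ 2)⁻¹) := by
          rw [hcdk, hGk]; ring
  -- (2) the time sums, uniformly in `x₁`
  have hT1 : ∀ x₁ : TorusSite 2 L, ∑ j₁ : Fin N, (if cd (j₁, x₁) = 0 then 0 else (1 + ε * cd (j₁, x₁)) ^ k / cd (j₁, x₁)) ≤
      2 * ((1 + β) ^ k * (1 + Real.log N)) := by
    intro x₁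
    have h := sum_fin_cyclicDist_le (N := N) (fun i : ℕ => if i = 0 then (0 : ℝ) else (1 + ε * i) ^ k / i)
      (fun i => by split_ifs <;> positivity) p₀.1
    have hg := sum_range_ite_pow_div_le hε0.le k N
    rw [show ε * N = β by rw [hε]; field_simp] at hg
    refine le_trans (le_of_eq (Finset.sum_congr rfl fun j₁ _ => ?_)) (h.trans (by nlinarith))
    simp only [hcd, cyclicDist, Nat.cast_eq_zero]
  have hT2 : ∀ x₁ : TorusSite 2 L, ∑ j₁ : Fin N, ((1 + ε / ℓ * cd (j₁, x₁)) ^ 2)⁻¹ ≤ 2 * (1 + ℓ * N / β) := by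
    intro x₁
    have h := sum_fin_cyclicDist_le (N := N) (fun i : ℕ => ((1 + ε / ℓ * i) ^ 2)⁻¹) (fun i => by positivity) p₀.1
    have hg := sum_range_inv_one_add_mul_pow_le (ε := ε / ℓ) (by positivity) (le_refl 2) N
    rw [show 1 / (ε / ℓ) = ℓ * N / β by rw [hε]; field_simp] at hg
    refine le_trans (le_of_eq (Finset.sum_congr rfl fun j₁ _ => ?_)) (h.trans (by nlinarith))
    simp only [hcd, cyclicDist]
  -- (3) the spatial sums
  have hzc0 : zc p₀.2 = 0 := by funext j; simp [hzc]
  have hSx : ∑ x₁ : TorusSite 2 L, ((1 + ‖zc x₁‖) ^ 4)⁻¹ ≤ S := sum_torusSite_inv_pow_centredRep_le_tsum p₀.2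
  have hEDsum : ∑ x₁ : TorusSite 2 L, (1 + ‖zc x₁‖) ^ k * ED x₁ ≤ EDon + EDoff * S := by
    have hle : ∀ x₁, (1 + ‖zc x₁‖) ^ k * ED x₁ ≤ (if x₁ = p₀.2 then EDon else 0) + EDoff * ((1 + ‖zc x₁‖) ^ 4)⁻¹ := by
      intro x₁
      simp only [hED]
      split_ifs with h
      · subst h; rw [hzc0, norm_zero, add_zero, one_pow, one_mul, one_pow, inv_one, mul_one]; linarith
      · refine le_of_eq ?_
        have hA : (1 + ‖zc x₁‖) ^ k ≠ 0 := by positivity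
        rw [zero_add, pow_add, mul_inv]
        field_simp
    refine (Finset.sum_le_sum fun x₁ _ => hle x₁).trans ?_
    rw [Finset.sum_add_distrib, Finset.sum_ite_eq' Finset.univ p₀.2, if_pos (Finset.mem_univ _), ← Finset.mul_sum]
    exact add_le_add le_rfl (mul_le_mul_of_nonneg_left hSx hEDoff)
  have hGsum : ∑ x₁ : TorusSite 2 L, (1 + ‖zc x₁‖) ^ k * G x₁ ≤ Gon + Goff * S := by
    have hle : ∀ x₁, (1 + ‖zc x₁‖) ^ k * G x₁ ≤ (if x₁ = p₀.2 then Gon else 0) + Goff * ((1 + ‖zc x₁‖) ^ 4)⁻¹ := by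
      intro x₁
      simp only [hG]
      split_ifs with h
      · subst h; rw [hzc0, norm_zero, add_zero, one_pow, one_mul, one_pow, inv_one, mul_one]; linarith
      · refine le_of_eq ?_
        have hA : (1 + ‖zc x₁‖) ^ k ≠ 0 := by positivity
        rw [zero_add, pow_add, mul_inv]
        field_simp
    refine (Finset.sum_le_sum fun x₁ _ => hle x₁).trans ?_
    rw [Finset.sum_add_distrib, Finset.sum_ite_eq' Finset.univ p₀.2, if_pos (Finset.mem_univ _), ← Finset.mul_sum]
    exact add_le_add le_rfl (mul_le_mul_of_nonneg_left hSx hGoff)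
  -- (4) assemble: Σ_{p₁} = Σ_{x₁} Σ_{j₁}
  calc ∑ p₁ : GridPoint L N, F p₁ * (1 + lam * (β / N * cd p₁ + torusSiteDist p₀.2 p₁.2)) ^ k
      ≤ ∑ p₁ : GridPoint L N, (1 + ‖zc p₁.2‖) ^ k * (ED p₁.2 * (if cd p₁ = 0 then 0 else (1 + ε * cd p₁) ^ k / cd p₁) +
          G p₁.2 * ((1 + ε / ℓ * cd p₁) ^ 2)⁻¹) := Finset.sum_le_sum fun p₁ _ => hpt p₁
    _ = ∑ x₁ : TorusSite 2 L, ∑ j₁ : Fin N, (1 + ‖zc x₁‖) ^ k * (ED x₁ * (if cd (j₁, x₁) = 0 then 0 else (1 + ε * cd (j₁, x₁)) ^ k / cd (j₁, x₁)) +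
          G x₁ * ((1 + ε / ℓ * cd (j₁, x₁)) ^ 2)⁻¹) := by
        rw [Fintype.sum_prod_type, Finset.sum_comm]
    _ = ∑ x₁ : TorusSite 2 L, ((1 + ‖zc x₁‖) ^ k * ED x₁ * ∑ j₁ : Fin N, (if cd (j₁, x₁) = 0 then 0 else (1 + ε * cd (j₁, x₁)) ^ k / cd (j₁, x₁)) +
          (1 + ‖zc x₁‖) ^ k * G x₁ * ∑ j₁ : Fin N, ((1 + ε / ℓ * cd (j₁, x₁)) ^ 2)⁻¹) := by
        refine Finset.sum_congr rfl fun x₁ _ => ?_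
        rw [Finset.mul_sum, Finset.mul_sum, ← Finset.sum_add_distrib]
        exact Finset.sum_congr rfl fun j₁ _ => by ring
    _ ≤ ∑ x₁ : TorusSite 2 L, ((1 + ‖zc x₁‖) ^ k * ED x₁ * (2 * ((1 + β) ^ k * (1 + Real.log N))) +
          (1 + ‖zc x₁‖) ^ k * G x₁ * (2 * (1 + ℓ * N / β))) := by
        refine Finset.sum_le_sum fun x₁ _ => add_le_add ?_ ?_
        · exact mul_le_mul_of_nonneg_left (hT1 x₁) (mul_nonneg (by positivity) (hED0 _))
        · exact mul_le_mul_of_nonneg_left (hT2 x₁) (mul_nonneg (by positivity) (hG0 _))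
    _ = 2 * ((1 + β) ^ k * (1 + Real.log N)) * ∑ x₁ : TorusSite 2 L, (1 + ‖zc x₁‖) ^ k * ED x₁ +
          2 * (1 + ℓ * N / β) * ∑ x₁ : TorusSite 2 L, (1 + ‖zc x₁‖) ^ k * G x₁ := by
        rw [Finset.sum_add_distrib, Finset.mul_sum, Finset.mul_sum]
        congr 1 <;> exact Finset.sum_congr rfl fun x₁ _ => by ring
    _ ≤ 2 * ((1 + β) ^ k * (1 + Real.log N)) * (EDon + EDoff * S) + 2 * (1 + ℓ * N / β) * (Gon + Goff * S) := by
        have hlog : 0 ≤ 1 + Real.log N := by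
          have : 0 ≤ Real.log N := Real.log_nonneg (by exact_mod_cast Nat.pos_of_ne_zero (NeZero.ne N))
          linarith
        exact add_le_add (mul_le_mul_of_nonneg_left hEDsum (by positivity)) (mul_le_mul_of_nonneg_left hGsum (by positivity))
    _ = _ := by ring

end Summit.HubbardSuperconductivity.HubbardSuperconductivity.Theorems.KLRegimeSplit

end
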